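/-
Copyright (c) 2026 the pub-hodgecm-mathlib formalisation cell (harness21).  Prover seat hodgecm-mathlib-F0P2-p09 (g0) (Track A «FOUR-FRAME», re-dealt to strike line L1 ∕
Track B «K2-LIT», hLiu418 = stmt-HodgeConjecture-24832): socket #42S, organ (S5-c) — STEP 2 of the constant-term letters payer: THE SECTION LAW OF THE CONTINUED BIG
CELL ON THE WHOLE WINDOW `{0 < re}` (LEAD F0P6-plan (g14) RULING M-158h (b): «the big-cell law continued from ★ F1b∕★ reflect INSIDE the payer, identity theorem»).
THEOREMS ONLY (no `def`, no `instance`, no notation, no named-fact hypothesis, no `sorry`).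
-/
import Summits.HodgeConjecture.HodgeConjecture.Theorems.K2LiuSiegelEisensteinResidueCoefficients     -- ★ I5 file 1: `eqOn_halfPlane_of_eqOn_right`
import Summits.HodgeConjecture.HodgeConjecture.Theorems.K2LiuIntertwiningDeltaReflect               -- ★ `intertwiningDelta_family_equivariant_reflect` (M(s): I(s,χ) → I(−s,χʷ))
import HarnessLib

/-!
# Crux `HLiu418`, socket #42S, organ (S5-c), step 2: THE CONTINUED BIG CELL IS `(χʷ, −s)`-EQUIVARIANT ON THE WHOLE WINDOW —
# `E₈ s (p·h) = χʷ_det(p)·modΔ(p)^{n−2s} · E₈ s h` for `p ∈ P_Δ(𝔸)` and EVERY `0 < re s`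

Cell `hodgecm-mathlib`, crux item hLiu418 = `stmt-HodgeConjecture-24832`; squad K2, LEAD F0P6-plan (g14); prover F0P2-p09 (g0).  Lane
`--supports stmt-HodgeConjecture-24832 --as helper` (count-neutral).

The KIND-0 big-cell organ output `E₈` (★ ed. 4a `exists_constantTerm_package` currency: (i) `s ↦ E₈ s h` holomorphic on `{0 < re}`, (iv)
`E₈ s h = (∏_{p∈Q}(s−p))·(∫β)⁻¹·M(s)f_s(h)` on `{n∕2 < re}`) inherits, for a family of Siegel sections `f_s ∈ I(s, χ)`, the law of ★
`K2LiuIntertwiningDeltaReflect.intertwiningDelta_family_equivariant_reflect` (`M(s) : I(s, χ) → I(−s, χʷ)`, unconditional) on the convergence half-plane, and the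
identity theorem (★ `eqOn_halfPlane_of_eqOn_right`; the character `s ↦ χʷ_det(p)·modΔ(p)^{n−2s}` is entire) carries it to every `0 < re s` — in particular to the pole
`s = ½` of socket #42S's organ S5, where `E₈(½) ∈ I(−½, χʷ)` is the section summand of the (S5-c) letters.
References: [MoeglinWaldspurger1995, II.1.7, IV.1.9–IV.1.11]; [KudlaSweet1997, §1]; [Garrett2018, §3.10–§3.12].
HONEST LABEL.  Count-neutral helper: `HC_CM` is proved only modulo the 7 printed citations (2 remaining named inputs: hLiu418 = `stmt-HodgeConjecture-24832`,
h413 = `stmt-HodgeConjecture-24833`) until rung 0 closes.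
-/

set_option autoImplicit false
set_option linter.dupNamespace false -- the mandated namespace repeats `HodgeConjecture.HodgeConjecture`

noncomputable section

open scoped Matrix Topology ENNReal NNReal BigOperators
open NumberField IsDedekindDomain MeasureTheory Filter
open Literature.NumberTheory.GelbartRogawski1991.AdaptedBlocks
open Literature.NumberTheory.Automorphic Literature.NumberTheory.Automorphic.UnitaryGroup
open Literature.NumberTheory.GelbartRogawski1991 Literature.NumberTheory.GelbartRogawski1991.GRConstruction
open Literature.NumberTheory.K2Lit.SiegelDoubled Literature.NumberTheory.GaloisRepresentations Literature.MeasureTheory.Group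
open UnitaryDualPair

namespace Summit.HodgeConjecture.HodgeConjecture.Cruxes.HLiu418.K2LiuContinuedBigCellSectionLaw

open K2LiuSiegelUnipotentFourierDefs
open K2LiuSiegelEisensteinResidueCoefficients (eqOn_halfPlane_of_eqOn_right)
open K2LiuIntertwiningDeltaReflect (intertwiningDelta_family_equivariant_reflect)
open Summit.HodgeConjecture.HodgeConjecture.Cruxes.H413.K2E1CharacterEisensteinU2Defs (reflectChar)

variable (L : Type) [Field L] [NumberField L] [IsCMField L] {N M n : ℕ} (e : Fin N × Fin M ≃ Fin n)
  (dV : Fin N → L) (hdV : ∀ i, IsCMField.complexConj L (dV i) = dV i)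
  (dW : Fin M → L) (hdW : ∀ i, IsCMField.complexConj L (dW i) = dW i)

/-- **THE CONTINUED BIG CELL IS `(χʷ, −s)`-EQUIVARIANT ON `{0 < re}`.**  For a family of Siegel sections `f_s ∈ I(s, χ)`, a carrier `(νN, β)`, and a big-cell organ output
`E₈` holomorphic on `{0 < re}` with `E₈ s h = (∏_{p∈Q}(s−p))·(∫β)⁻¹·M(s)f_s(h)` on `{c < re}` (`0 ≤ c`; ★ ed. 4a: `c = n∕2`): for every Siegel element `p` and every
`0 < re s`, `E₈ s (p·h) = χʷ_det(p)·modΔ(p)^{n−2s}·E₈ s h`. [cite: MoeglinWaldspurger1995, II.1.7, IV.1.9–IV.1.11] [cite: KudlaSweet1997, §1] -/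
theorem bigCell_continuation_equivariant (hdV0 : ∀ i, dV i ≠ 0) (hdW0 : ∀ i, dW i ≠ 0)
    (χ : HeckeCharacter L) (f : ℂ → HA L e dV hdV dW hdW → ℂ) (hf : ∀ s : ℂ, IsSiegelDeltaSection L e dV hdV dW hdW χ s (f s))
    [MeasurableSpace (unipDelta L e dV hdV dW hdW)] [BorelSpace (unipDelta L e dV hdV dW hdW)] (νN : Measure (unipDelta L e dV hdV dW hdW)) [νN.IsHaarMeasure]
    (β : unipDelta L e dV hdV dW hdW → ℝ≥0∞) {c : ℝ} (hc : 0 ≤ c) (Q : Finset ℂ)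
    (E₈ : ℂ → HA L e dV hdV dW hdW → ℂ) (h8d : ∀ h : HA L e dV hdV dW hdW, DifferentiableOn ℂ (fun s => E₈ s h) {s : ℂ | 0 < s.re})
    (h8eq : ∀ (s : ℂ) (h : HA L e dV hdV dW hdW), c < s.re →
      E₈ s h = (∏ p ∈ Q, (s - p)) * (((∫⁻ u, β u ∂νN).toReal⁻¹ : ℝ) • intertwiningDelta L e dV hdV dW hdW νN (f s) h))
    {p : HA L e dV hdV dW hdW} (hp : IsSiegelDelta L e dV hdV dW hdW p) (h : HA L e dV hdV dW hdW) :
    ∀ s : ℂ, 0 < s.re → E₈ s (p * h) =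
      (((chiDet L e dV hdV dW hdW (reflectChar (IsCMField.complexConj L : L ≃ₐ[Fp L] L) χ) p : ℂˣ) : ℂ) *
          ((modDelta L e dV hdV dW hdW p : ℝ) : ℂ) ^ (((n : ℝ) : ℂ) - 2 * s)) * E₈ s h := by
  have hm : ((modDelta L e dV hdV dW hdW p : ℝ) : ℂ) ≠ 0 := by exact_mod_cast (modDelta_pos L e dV hdV dW hdW p).ne'
  refine eqOn_halfPlane_of_eqOn_right (h8d (p * h)) ?_ hc fun s hs => ?_
  · -- the character is entire in `s`
    exact ((differentiableOn_const _).mul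
      (((differentiableOn_const _).sub (differentiableOn_id.const_mul _)).const_cpow (Or.inl hm))).mul (h8d h)
  · -- on the convergence half-plane: ★ reflect, family form, with `a s := (∏_Q(s−p))·(∫β)⁻¹`
    have key := intertwiningDelta_family_equivariant_reflect L e dV hdV dW hdW hdV0 hdW0 νN χ c f hf
      (fun s => (∏ p ∈ Q, (s - p)) * ((((∫⁻ u, β u ∂νN).toReal⁻¹ : ℝ) : ℂ))) s hs p hp h
    beta_reduce at key
    rw [h8eq s (p * h) hs, h8eq s h hs, Complex.real_smul, Complex.real_smul]
    linear_combination key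

end Summit.HodgeConjecture.HodgeConjecture.Cruxes.HLiu418.K2LiuContinuedBigCellSectionLaw

end
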